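import Mathlib
import Literature.Combinatorics.Optimization.MaxThreeSatSdpLowerBound

/-!
# MAX-3SAT: no LP relaxation of size `2^{c n^{1/H}}` beats `7/8` (Kothari–Meka–Raghavendra 2017/22,
Corollary 1.5), DERIVED from Theorem 1.10 and the Grigoriev/Schoenebeck lower bound

A companion to `MaxThreeSatSdpLowerBound.lean` (the SDP side).  Nothing new is vendored: this file
ASSEMBLES, as a theorem, the MAX-3SAT clause of Kothari–Meka–Raghavendra's Corollary 1.5 — typed
verbatim as the named fact `KothariMekaRaghavendra2017_cor15_threeSat` in `LPRelaxationsMaxCSP.lean` —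
from the two engine facts it rests on in print:

* Theorem 1.2 in the form its printed proof delivers, itself a tree THEOREM modulo Theorem 1.10
  (`KothariMekaRaghavendra2017_thm12_of_thm110`, fourth append of `LPRelaxationsMaxCSP.lean`:
  conclusion for `(c − 1/n, s)` on `n^H` variables, guards `n ≥ n₀`, `1/n < c − s`, `f(n) ≥ 16k`);
* the linear-round Sherali–Adams lower bound for MAX-3SAT, Thm 1.4 (p. 4) = Thm 7.5 (p. 21) of the
  paper ("[Gri01, Schoenebeck08, BGMT12] … As a corollary, for some constants `c_1(ε), c_2(ε)`, the
  `c_1(ε)`-round Sherali-Adams relaxation for MAX-3SAT does not achieve a `(7/8+ε, 1−ε)`-approximation"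
  — the printed pair lists the soundness `7/8 + ε` first: some instance with `opt ≤ 7/8 + ε` has
  Sherali–Adams value `> 1 − ε`, in the tree's currency `¬ SAAchieves 𝒫 (c_1(ε)) (1 − ε) (7/8 + ε)`),
  which is NOT typed as a separate fact: for every completeness `c < 1` it FOLLOWS in the tree from
  the sum-of-squares bound `Schoenebeck2008_maxThreeSatSos` (LRS Thm 6.5; p. 21: "a strengthening
  of the Sherali-Adams LP hierarchy and thus the lower bounds carry over"),
  because a degree-`d` Sherali–Adams certificate `c − ℑ = Σ λ_i h_i` (`h_i ≥ 0` `d`-juntas; Fact 3.4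
  = [ChanEtAl2016] eq. (1.2), PROVED in `LPRelaxationsMaxCSP.lean`) is a sum of squares
  `Σ (√(λ_i h_i))²` of `d`-juntas, i.e. of functions of degree `≤ d` (`SAAchieves.achievesApprox`:
  "`d` rounds of Sherali–Adams are no stronger than degree-`2d` sos").

Main result: `KothariMekaRaghavendra2017_cor15_threeSat_of_thm110 :
KothariMekaRaghavendra2017_thm110 → Schoenebeck2008_maxThreeSatSos →
KothariMekaRaghavendra2017_cor15_threeSat`, following the printed proof of Cor. 1.5 (p. 21: apply
Thm 1.2 with `f(n) = αn` linear, `N = n^H`, size `n^{h f(n)} = 2^{Ω(N^{1/H} log N)}`), with the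
padding `N ↦ ⌊N^{1/H}⌋^H` (`LPRelaxation.restrict`) for numbers of variables that are not `H`-th
powers, the identification of KMR's "CSP(`or₃`) with literals" with LRS's "all eight 3-literal
disjunctions" (`literalClosure_orThree`), and "integrality gap `< 8/7 − ε`" ⇒ "achieves
`(c − 1/n, s)`" for `s = 7/8 + 7ε/32`, `c = 1 − ε/4` (`LPRelaxation.GapLT.achieves`).

Sources: P. K. Kothari, R. Meka, P. Raghavendra, *Approximating rectangles by juntas and weakly
exponential lower bounds for LP relaxations of CSPs*, STOC 2017 / SIAM J. Comput. 51 (2022)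
[KothariMekaRaghavendra2017]; held text `paper:arxiv-1610.02704` (Cor. 1.5 p. 4, Thm 1.4 p. 4,
§7 p. 20–21).  J. R. Lee, P. Raghavendra, D. Steurer, STOC 2015 [LeeRaghavendraSteurer2015], Thm 6.5
(p. 26 of `paper:arxiv-1411.6317`) for the Schoenebeck bound as typed.
-/

noncomputable section

open Finset Filter
open Literature.Computability.Complexity.LowDegree (cubeFourierCoeff cubeFourierCoeff_piecewise_eq_zero)

namespace Literature.Combinatorics.Optimization

/-! ### MAX-3SAT in the two vocabularies -/

/-- **MAX-3SAT:** Kothari–Meka–Raghavendra's CSP(`or₃`) with literals (`y ↦ (y ⊕ σ)_0 ∨ (y ⊕ σ)_1 ∨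
(y ⊕ σ)_2`) is Lee–Raghavendra–Steurer's "all eight 3-literal disjunctions" (`y ↦ [y ≠ σ]`): the two
predicate sets coincide. [cite: KothariMekaRaghavendra2017, §1 (p. 3: MAX-3SAT = CSP with literals)]
[cite: LeeRaghavendraSteurer2015, §1.2 (p. 6: "For Max 3-Sat, 𝒫 contains all eight 3-literal disjunctions")] -/
theorem literalClosure_orThree : literalClosure orThree = maxThreeSatPreds := by
  unfold literalClosure maxThreeSatPreds
  congr 1
  funext σ y
  revert σ y
  decide

/-! ### Juntas have low degree; Sherali–Adams certificates are sum-of-squares certificates -/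

/-- Post-composition preserves juntas. [cite: KothariMekaRaghavendra2017, Def. 1.8 (p. 4)] -/
theorem IsJunta.comp {n d : ℕ} {h : (Fin n → Bool) → ℝ} (hh : IsJunta d h) (φ : ℝ → ℝ) :
    IsJunta d (fun x => φ (h x)) := by
  obtain ⟨S, hS, hdep⟩ := hh
  refine ⟨S, hS, fun x y hxy => ?_⟩
  show φ (h x) = φ (h y)
  rw [hdep x y hxy]

/-- **A `d`-junta has degree `≤ d`** (as a multilinear polynomial): its Fourier–Walsh coefficients
vanish on every `T` not contained in its set of relevant coordinates (restriction lemma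
`cubeFourierCoeff_piecewise_eq_zero`), in particular on `|T| > d`.
[cite: KothariMekaRaghavendra2017, §3.3 (p. 9: "a d-junta … polynomial of degree at most d")] -/
theorem IsJunta.hasDegreeLE {n d : ℕ} {h : (Fin n → Bool) → ℝ} (hh : IsJunta d h) :
    HasDegreeLE d h := by
  classical
  obtain ⟨S, hS, hdep⟩ := hh
  refine hasDegreeLE_of_cubeFourierCoeff_eq_zero fun T hT => ?_
  have heq : h = fun x => h (Sᶜ.piecewise (fun _ => false) x) := by
    funext x
    refine hdep x _ fun i hi => ?_
    rw [Finset.piecewise_eq_of_notMem _ _ _ (by simpa using hi)]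
  rw [heq]
  refine cubeFourierCoeff_piecewise_eq_zero h Sᶜ (fun _ => false) ?_
  by_contra hcon
  push Not at hcon
  have hTS : T ⊆ S := fun i hi => by simpa using hcon i hi
  exact absurd ((Finset.card_le_card hTS).trans hS) (not_le.2 hT)

/-- **A conical `d`-junta `c − f = Σ λ_i h_i` is a sum of squares of `d`-juntas,
`Σ (√(λ_i h_i))²`, hence `c − f ∈ ΣU²` for `U` = the degree-`≤ d` functions.**
[cite: KothariMekaRaghavendra2017, Def. 1.8 and Fact 3.4 (pp. 4, 9)] -/
theorem IsConicalJunta.subspaceSos {n d : ℕ} {f : (Fin n → Bool) → ℝ} {c : ℝ}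
    (h : IsConicalJunta d (fun x => c - f x)) : SubspaceSos (degreeLE n d) f c := by
  obtain ⟨t, lam, g, hlam, hg, hg0, hsum⟩ := h
  refine ⟨t, fun i x => Real.sqrt (lam i * g i x), fun i => ?_, fun x => ?_⟩
  · exact ((hg i).comp fun u => Real.sqrt (lam i * u)).hasDegreeLE
  · have hx : c - f x = ∑ i, lam i * g i x := hsum x
    rw [hx]
    exact sum_congr rfl fun i _ => (Real.sq_sqrt (mul_nonneg (hlam i) (hg0 i x))).symm

/-- **`d` rounds of Sherali–Adams are no stronger than degree-`2d` sum of squares:** if the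
degree-`d` Sherali–Adams relaxation achieves a `(c,s)`-approximation on `n`-variable instances of
Max-`𝒫`, then so does the subspace of degree-`≤ d` functions (squares of degree `≤ d`), by Fact 3.4
(`SA_d(ℑ) ≤ c ⟺ c − ℑ` is a conical `d`-junta, PROVED in `LPRelaxationsMaxCSP.lean`) and
`IsConicalJunta.subspaceSos`. [cite: KothariMekaRaghavendra2017, Fact 3.4 (p. 9)] -/
theorem SAAchieves.achievesApprox {k n d : ℕ} {P : Set ((Fin k → Bool) → Bool)} {c s : ℝ}
    (h : SAAchieves (n := n) P d c s) : AchievesApprox P (degreeLE n d) c s :=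
  fun I hI => ((KothariMekaRaghavendra2017_fact34 I c).1 (h I hI)).subspaceSos

/-- **KMR Thm 1.4 = Thm 7.5 for MAX-3SAT ("[Gri01, Sch08]: `αn` rounds of Sherali–Adams do not beat
`7/8`"), DERIVED from `Schoenebeck2008_maxThreeSatSos`:** for every `ε > 0` there are `c_ε > 0` and
`n₀` such that for all `n ≥ n₀`, every `d` with `2d ≤ ⌊c_ε n⌋` and every `c < 1`, the degree-`d`
Sherali–Adams relaxation fails to achieve a `(c, 7/8 + ε)`-approximation for MAX-3SAT on `n`
variables. [cite: KothariMekaRaghavendra2017, Thm 1.4 (p. 4) and Thm 7.5 (p. 21)]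
[cite: LeeRaghavendraSteurer2015, Thm 6.5 (p. 26)] -/
theorem Schoenebeck2008_maxThreeSatSos.not_saAchieves (h65 : Schoenebeck2008_maxThreeSatSos)
    {ε : ℝ} (hε : 0 < ε) :
    ∃ cε : ℝ, 0 < cε ∧ ∃ n₀ : ℕ, ∀ n : ℕ, n₀ ≤ n → ∀ d : ℕ, 2 * d ≤ ⌊cε * n⌋₊ →
      ∀ c : ℝ, c < 1 → ¬ SAAchieves (n := n) maxThreeSatPreds d c (7 / 8 + ε) := by
  obtain ⟨cε, hcε, n₀, H⟩ := h65.not_achievesApprox hε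
  refine ⟨cε, hcε, n₀, fun n hn d hd c hc hSA => H n hn (2 * d) hd c hc ?_⟩
  rw [Nat.mul_div_cancel_left d two_pos]
  exact hSA.achievesApprox

/-! ### `opt(ℑ)`, integrality gap and `(c,s)`-approximation -/

namespace CSPInstance

variable {k n : ℕ} {P : Set ((Fin k → Bool) → Bool)}

/-- `opt(ℑ) ≤ s` from `ℑ ≤ s` pointwise. [cite: KothariMekaRaghavendra2017, eq. (1.1) (p. 3)] -/
theorem opt_le {I : CSPInstance k n P} {s : ℝ} (h : I.OptLE s) : I.opt ≤ s :=
  Finset.sup'_le _ _ fun x _ => h x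

/-- `opt(ℑ) ≥ 0`. [cite: KothariMekaRaghavendra2017, eq. (1.1) (p. 3)] -/
theorem opt_nonneg (I : CSPInstance k n P) : 0 ≤ I.opt :=
  (I.val_nonneg fun _ => false).trans (Finset.le_sup' I.val (Finset.mem_univ _))

end CSPInstance

namespace LPRelaxation

variable {k n R : ℕ} {P : Set ((Fin k → Bool) → Bool)}

/-- `opt_𝒫(ℑ) ≤ c` is monotone in `c`. [cite: KothariMekaRaghavendra2017, Def. 1.1 (p. 3)] -/
theorem ValueLE.mono {L : LPRelaxation k n P R} {I : CSPInstance k n P} {c c' : ℝ}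
    (h : L.ValueLE I c) (hcc' : c ≤ c') : L.ValueLE I c' :=
  fun y hy => (h y hy).trans hcc'

/-- "Integrality gap `< ρ`" is monotone in `ρ`. [cite: KothariMekaRaghavendra2017, Cor. 1.5 (p. 4)] -/
theorem GapLT.mono {L : LPRelaxation k n P R} {ρ ρ' : ℝ} (h : L.GapLT ρ) (hρ : ρ ≤ ρ') :
    L.GapLT ρ' := by
  obtain ⟨ρ₀, h₀, hA⟩ := h
  exact ⟨ρ₀, h₀.trans_le hρ, hA⟩

/-- **Integrality gap `< ρ` ⇒ `(c,s)`-approximation whenever `ρ s ≤ c` (`s, c ≥ 0`):** for `ℑ` with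
`opt(ℑ) ≤ s`, `opt_𝒫(ℑ) ≤ ρ' opt(ℑ) ≤ max(ρ',0) s ≤ c`. [cite: KothariMekaRaghavendra2017, §1.1 (p. 3) and Cor. 1.5 (p. 4)] -/
theorem GapLT.achieves {L : LPRelaxation k n P R} {ρ c s : ℝ} (h : L.GapLT ρ) (hs : 0 ≤ s)
    (hc : ρ * s ≤ c) (hc0 : 0 ≤ c) : L.Achieves c s := by
  obtain ⟨ρ', hρ', hA⟩ := h
  intro I hI
  refine (hA I).mono ?_
  have h1 := I.opt_nonneg
  have h2 := CSPInstance.opt_le hI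
  rcases le_or_gt 0 ρ' with hρ0 | hρ0
  · calc ρ' * I.opt ≤ ρ' * s := mul_le_mul_of_nonneg_left h2 hρ0
      _ ≤ ρ * s := mul_le_mul_of_nonneg_right hρ'.le hs
      _ ≤ c := hc
  · nlinarith

end LPRelaxation

/-! ### Corollary 1.5 (MAX-3SAT) from Theorem 1.10 and the Schoenebeck bound -/

set_option maxHeartbeats 400000 in
/-- **Kothari–Meka–Raghavendra 2017/22, Corollary 1.5 (MAX-3SAT) DERIVED from Theorem 1.10 and
`Schoenebeck2008_maxThreeSatSos`:** for the universal `H` of Thm 1.2, for every `ε > 0` there are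
`c₁ > 0` and `n₀` such that for all `n ≥ n₀` no LP relaxation of MAX-3SAT on `n` variables of size
`R < 2^{c₁ n^{1/H}}` has integrality gap less than `8/7 − ε`.  Proof as printed (p. 21), made
explicit: WLOG `ε ≤ 1/100`; with `s = 7/8 + 7ε/32`, `c = 1 − ε/4`, `f(m) = ⌊(c_ε/2) m⌋`
(`c_ε` = Schoenebeck's constant for `7ε/32`), the degree-`f(m)` Sherali–Adams relaxation fails
`(c,s)` on `m` variables for all large `m` (`Schoenebeck2008_maxThreeSatSos.not_saAchieves`); Thm 1.2
(from Thm 1.10, `KothariMekaRaghavendra2017_thm12_of_thm110`) makes every LP relaxation of size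
`≤ m^{h f(m)}` on `m^H` variables fail `(c − 1/m, s)`; an LP relaxation on `n ≥ m^H` variables,
`m = ⌊n^{1/H}⌋`, with gap `< 8/7 − ε` restricts (`LPRelaxation.restrict`) to one on `m^H` variables
achieving `((8/7 − ε)s, s)`, and `(8/7 − ε) s ≤ c − 1/m`; finally `2^{c₁ n^{1/H}} ≤ m^{h f(m)}` for
`c₁ = h c_ε / 8`. [cite: KothariMekaRaghavendra2017, Cor. 1.5 (p. 4) and its proof (§7, p. 21)] -/
theorem KothariMekaRaghavendra2017_cor15_threeSat_of_thm110
    (h110 : KothariMekaRaghavendra2017_thm110) (h65 : Schoenebeck2008_maxThreeSatSos) :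
    KothariMekaRaghavendra2017_cor15_threeSat := by
  obtain ⟨h, H, n₀, hh, hhH, T12⟩ := KothariMekaRaghavendra2017_thm12_of_thm110 h110
  have hH0 : H ≠ 0 := by
    rintro rfl
    simp at hhH
    linarith
  have hH1 : (1 : ℝ) ≤ H := by exact_mod_cast Nat.one_le_iff_ne_zero.2 hH0
  have hHpos : (0 : ℝ) < H := by linarith
  refine ⟨H, hH1, ?_⟩
  -- WLOG `ε ≤ 1/100`
  suffices main : ∀ ε : ℝ, 0 < ε → ε ≤ 1 / 100 → ∃ c₁ : ℝ, 0 < c₁ ∧ ∃ N₀ : ℕ, ∀ N : ℕ, N₀ ≤ N →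
      ∀ R : ℕ, (R : ℝ) < (2 : ℝ) ^ (c₁ * (N : ℝ) ^ (1 / (H : ℝ))) →
        ∀ L : LPRelaxation 3 N (literalClosure orThree) R, ¬ L.GapLT (8 / 7 - ε) by
    intro ε hε
    obtain ⟨c₁, hc₁, N₀, hN₀⟩ := main (min ε (1 / 100)) (lt_min hε (by norm_num)) (min_le_right _ _)
    exact ⟨c₁, hc₁, N₀, fun N hN R hR L hL =>
      hN₀ N hN R hR L (hL.mono (by linarith [min_le_left ε (1 / 100)]))⟩
  intro ε hε hε1
  rw [literalClosure_orThree]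
  -- the Sherali–Adams lower bound (Thm 7.5) at soundness `7/8 + 7ε/32`
  obtain ⟨cε, hcε, n₁, H65⟩ := h65.not_saAchieves (by positivity : 0 < 7 * ε / 32)
  -- parameters
  set s : ℝ := 7 / 8 + 7 * ε / 32 with hsdef
  set c : ℝ := 1 - ε / 4 with hcdef
  have hs0 : 0 ≤ s := by rw [hsdef]; positivity
  have hc1 : c < 1 := by rw [hcdef]; linarith
  have hcs : 1 / 10 < c - s := by rw [hcdef, hsdef]; linarith
  set f : ℕ → ℕ := fun m => ⌊cε / 2 * m⌋₊ with hfdef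
  set c₁ : ℝ := h * cε / 8 with hc₁def
  have hc₁ : 0 < c₁ := by rw [hc₁def]; positivity
  -- thresholds
  set nthr : ℕ := n₀ + n₁ + 10 + ⌈98 / cε⌉₊ + ⌈3 / ε⌉₊ with hnthr
  refine ⟨c₁, hc₁, (nthr + 1) ^ H, fun N hN R hR L hL => ?_⟩
  -- `y = N^{1/H}`, `m = ⌊y⌋`
  set y : ℝ := (N : ℝ) ^ (1 / (H : ℝ)) with hydef
  have hy0 : 0 ≤ y := Real.rpow_nonneg (Nat.cast_nonneg N) _
  have hyH : y ^ H = N := by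
    rw [hydef, one_div]; exact Real.rpow_inv_natCast_pow (Nat.cast_nonneg N) hH0
  have hythr : (nthr : ℝ) + 1 ≤ y := by
    have h1 : (((nthr + 1) ^ H : ℕ) : ℝ) ≤ N := by exact_mod_cast hN
    have h2 : ((((nthr + 1) ^ H : ℕ) : ℝ)) ^ (1 / (H : ℝ)) ≤ y :=
      Real.rpow_le_rpow (Nat.cast_nonneg _) h1 (by positivity)
    have h3 : ((((nthr + 1) ^ H : ℕ) : ℝ)) ^ (1 / (H : ℝ)) = nthr + 1 := by
      push_cast
      rw [one_div]
      exact Real.pow_rpow_inv_natCast (by positivity) hH0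
    linarith
  set m : ℕ := ⌊y⌋₊ with hmdef
  have hmy : (m : ℝ) ≤ y := Nat.floor_le hy0
  have hmy' : y - 1 ≤ (m : ℝ) := (Nat.sub_one_lt_floor y).le
  have hmthr : nthr ≤ m := by
    have : (nthr : ℝ) ≤ m := by linarith
    exact_mod_cast this
  have hnthr10 : (10 : ℝ) ≤ nthr := by exact_mod_cast (by omega : 10 ≤ nthr)
  have hmy2 : y / 2 ≤ (m : ℝ) := by linarith
  have hmH : m ^ H ≤ N := by
    have h1 : ((m : ℝ)) ^ H ≤ y ^ H := pow_le_pow_left₀ (Nat.cast_nonneg m) hmy H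
    rw [hyH] at h1
    exact_mod_cast h1
  -- consequences of `m ≥ nthr`
  have hmn₀ : n₀ ≤ m := by omega
  have hmn₁ : n₁ ≤ m := by omega
  have hm10 : 10 ≤ m := by omega
  have hmR : (10 : ℝ) ≤ m := by exact_mod_cast hm10
  have hm0 : (0 : ℝ) < m := by linarith
  have hm98 : 98 / cε ≤ (m : ℝ) := by
    have h1 : ⌈98 / cε⌉₊ ≤ m := by omega
    exact (Nat.le_ceil _).trans (by exact_mod_cast h1)
  have hm3 : 3 / ε ≤ (m : ℝ) := by
    have h1 : ⌈3 / ε⌉₊ ≤ m := by omega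
    exact (Nat.le_ceil _).trans (by exact_mod_cast h1)
  have hcεm : 98 ≤ cε * m := by
    rw [div_le_iff₀ hcε] at hm98; linarith
  have h1m : 1 / (m : ℝ) ≤ 1 / 10 := one_div_le_one_div_of_le (by norm_num) hmR
  have h1mε : 1 / (m : ℝ) ≤ ε / 3 := by
    have h1 : 1 / (m : ℝ) ≤ 1 / (3 / ε) := one_div_le_one_div_of_le (by positivity) hm3
    rwa [one_div_div] at h1
  -- `f(m)`: `2 f(m) ≤ ⌊cε m⌋`, `48 ≤ f(m)`, `f(m) ≥ (cε/4) m`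
  have hfm_le : ((f m : ℕ) : ℝ) ≤ cε / 2 * m := Nat.floor_le (by positivity)
  have hfm_ge : cε / 2 * m - 1 ≤ ((f m : ℕ) : ℝ) := (Nat.sub_one_lt_floor _).le
  have h2f : 2 * f m ≤ ⌊cε * m⌋₊ := by
    apply Nat.le_floor
    push_cast
    linarith
  have h48 : 16 * 3 ≤ f m := by
    show 48 ≤ f m
    apply Nat.le_floor
    push_cast
    linarith
  have hfm4 : cε / 4 * m ≤ ((f m : ℕ) : ℝ) := by linarith
  -- Sherali–Adams fails `(c,s)` at degree `f(m)` on `m` variables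
  have hSA : ¬ SAAchieves (n := m) maxThreeSatPreds (f m) c s := H65 m hmn₁ (f m) h2f c hc1
  -- the restricted relaxation achieves `(c − 1/m, s)` on `m^H` variables
  have hgap : 1 / (m : ℝ) < c - s := by linarith
  have hρ : (8 / 7 - ε) * s ≤ c - 1 / m := by
    have h1 : (8 / 7 - ε) * s = 1 - 5 * ε / 8 - 7 * ε ^ 2 / 32 := by rw [hsdef]; ring
    rw [h1, hcdef]
    nlinarith [sq_nonneg ε]
  have hc0 : 0 ≤ c - 1 / m := by rw [hcdef]; linarith
  have hAch : (L.restrict (Fin.castLEEmb hmH)).Achieves (c - 1 / m) s :=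
    (hL.achieves hs0 hρ hc0).restrict _
  -- the size bound: `R < 2^{c₁ N^{1/H}} ≤ m^{h f(m)}`
  have hkey : (2 : ℝ) ^ (c₁ * y) ≤ (m : ℝ) ^ (h * (f m : ℕ)) := by
    rw [Real.rpow_def_of_pos two_pos, Real.rpow_def_of_pos hm0, Real.exp_le_exp]
    have hlog2 : 0 < Real.log 2 := Real.log_pos one_lt_two
    have hlog2m : Real.log 2 ≤ Real.log m := Real.log_le_log two_pos (by linarith)
    have hfy : cε / 4 * (y / 2) ≤ ((f m : ℕ) : ℝ) := by nlinarith
    calc Real.log 2 * (c₁ * y) = Real.log 2 * h * (cε / 4 * (y / 2)) := by rw [hc₁def]; ring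
      _ ≤ Real.log 2 * h * ((f m : ℕ) : ℝ) :=
          mul_le_mul_of_nonneg_left hfy (by positivity)
      _ ≤ Real.log m * h * ((f m : ℕ) : ℝ) := by
          apply mul_le_mul_of_nonneg_right (mul_le_mul_of_nonneg_right hlog2m hh.le)
          positivity
      _ = Real.log m * (h * ((f m : ℕ) : ℝ)) := by ring
  have hRle : (R : ℝ) ≤ (m : ℝ) ^ (h * (f m : ℕ)) := (hR.trans_le hkey).le
  exact T12 3 maxThreeSatPreds c s hc1.le f m hmn₀ hgap h48 hSA R hRle _ hAch

end Literature.Combinatorics.Optimization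

end
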